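import Literature.NumberTheory.ModularForms.BinaryQuadGaussSumCoprime
import HarnessLib

/-!
# Gauss sums of binary quadratic forms, VI: moduli `2^k` — the recursion `G_{2^{k+2}} = 4·G_{2^k}`
# and the values `G(a, 2^k; f, 0) = χ₈(D)^k · 2^k` for odd discriminant

Topic `NumberTheory/ModularForms` (namespace `Literature.NumberTheory.ModularForms`), continuing
`BinaryQuadGaussSum{,Basic,Coprime}.lean`. Everything here is PROVED (theorems only; no
definition, no named fact). The odd-modulus theory (files II–IV) diagonalises the form, which
needs `2` to be a unit; for the `2`-part of the modulus (reached through the Chinese remainder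
theorem of file V) one argues directly, as in the one-variable `G(a; p^{e+2}) = p·G(a; p^e)`
(Andrianov–Zhuravlev, proof of Lemma 4.13: "set `r = r₁ + p^{n−1}r₂` … `G_{p^n}(c) = pG_{p^{n−2}}(c)`"),
here with the factor `p² = 4` of a two-dimensional sum. With `f = (A, B, C)`, `D = B² − 4AC`:

* `binQuadGaussSum_eq_one_of_modulus_eq_one` — `G(a, 1; f, w) = 1`.
* `binQuadGaussSum_two_pow_add_two` — **`G(a, 2^{k+2}; f, 0) = 4·G(a, 2^k; f, 0)` for odd `a`
  and odd `B`** (i.e. odd `D`): writing `x = u + 2^{k+1}s`, `y = u' + 2^{k+1}t` (`s, t ∈ {0,1}`),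
  `e(a f(x,y)/2^{k+2}) = e(a f(u,u')/2^{k+2})·(−1)^{aB(ut + su')}`, the sums over `s, t` force
  `u, u'` even, and `f(2v, 2v')/2^{k+2} = f(v, v')/2^k`.
* `binQuadGaussSum_eq_of_modulus_eq_two` — `G(a, 2; f, 0) = 2·χ₈(D)` for odd `a`, `B`
  (`χ₈(D) = +1` for `D ≡ 1 (mod 8)` — `AC` even — and `−1` for `D ≡ 5 (mod 8)`, `AC` odd: the
  Kronecker symbol `(D/2)`; cf. (4.34) `χ_Q(2) = 2^{-k}∑_{t mod 2} e(Q[t]/4)`), and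
* `binQuadGaussSum_two_pow_eq` — **`G(a, 2^k; f, 0) = χ₈(D)^k · 2^k`** for odd `a` and odd `B`
  (two-step induction). (Mathlib's `jacobiSym D (2^k)` is `1` for odd `D`, so the Kronecker
  symbol at `2` is written with `ZMod.χ₈`.)

Together with `binQuadGaussSum_mul_of_coprime` (file V) and the odd-modulus values (files III/IV)
this evaluates `∑_{x,y mod c} e(a f(x,y)/c)` for EVERY modulus `c` prime to `aD` (`D` odd), as
the theta-transformation law at all cusps `a/c` requires; the twisted sums at `2^k` are reduced to
the untwisted ones by `binQuadGaussSum_eq_stdAddChar_mul` (file II), which needs no parity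
hypothesis (`D` odd is a unit mod `2^k`).

## References

* A. N. Andrianov, V. G. Zhuravlev, *Modular Forms and Hecke Operators*, Transl. Math. Monogr.
  145, AMS (1995/2015), Ch. 1 §4.4 Proposition 4.9, (4.34); §4.5, proof of Lemma 4.13
  [AndrianovZhuravlev2015].
* B. Conrey, H. Iwaniec, Acta Arith. 103 (2002) 259–312, §3 (3.14)–(3.21) [ConreyIwaniec2002].
-/

noncomputable section

open Complex Finset

namespace Literature.NumberTheory.ModularForms

open Literature.NumberTheory.EllipticCurves.ModularForms
open Literature.NumberTheory.QuadraticFields.Quadratic (BinQF)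
open Literature.NumberTheory.LFunctions (sum_zmod_eq_sum_range sum_range_mul_eq_sum_sum
  norm_stdAddChar)

/-! ### The untwisted sum over representatives -/

/-- `G(a, c; f, 0) = ∑_{x<c}∑_{y<c} exp(2πi·a f(x,y)/c)` (integer numerator, no twist).
[cite: AndrianovZhuravlev2015, Ch. 1 §4.3 (4.10)] -/
theorem binQuadGaussSum_zero_zero_eq_sum_range {c : ℕ} [NeZero c] (f : BinQF) (a : ℤ) :
    binQuadGaussSum c f a 0 0 = ∑ x ∈ range c, ∑ y ∈ range c,
      cexp (2 * Real.pi * I * ((a * (f.a * x ^ 2 + f.b * x * y + f.c * y ^ 2) : ℤ) : ℂ) / c) := by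
  have h := binQuadGaussSum_eq_sum_range (c := c) f a 0 0
  simp only [Int.cast_zero, zero_mul, add_zero] at h
  exact h

/-! ### Modulus `1` -/

/-- `G(a, c; f, w) = 1` for `c = 1` (the one-point sum). [cite: AndrianovZhuravlev2015, Ch. 1 §4.3 (4.10)] -/
theorem binQuadGaussSum_eq_one_of_modulus_eq_one {c : ℕ} [NeZero c] (hc : c = 1) (f : BinQF)
    (a w₁ w₂ : ZMod c) : binQuadGaussSum c f a w₁ w₂ = 1 := by
  subst hc
  rw [binQuadGaussSum_def]
  have : ∀ v : ZMod 1 × ZMod 1, (ZMod.stdAddChar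
      (a * ((f.a : ZMod 1) * v.1 ^ 2 + (f.b : ZMod 1) * v.1 * v.2 + (f.c : ZMod 1) * v.2 ^ 2) +
        w₁ * v.1 + w₂ * v.2) : ℂ) = 1 := fun v ↦ by
    rw [Subsingleton.elim (a * ((f.a : ZMod 1) * v.1 ^ 2 + (f.b : ZMod 1) * v.1 * v.2 +
      (f.c : ZMod 1) * v.2 ^ 2) + w₁ * v.1 + w₂ * v.2) 0, AddChar.map_zero_eq_one]
  simp only [this, sum_const, card_univ, Fintype.card_prod, ZMod.card, mul_one, one_smul]

/-! ### The recursion `G_{2^{k+2}} = 4·G_{2^k}` -/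

/-- `∑_{u < 2m} [2 ∣ u]·2·F(u) = 2∑_{v < m} F(2v)` (plumbing for the even/odd splitting).
[folklore] -/
private theorem sum_range_two_mul_ite (m : ℕ) (F : ℕ → ℂ) :
    ∑ u ∈ range (2 * m), (if 2 ∣ u then (2 : ℂ) else 0) * F u =
      2 * ∑ v ∈ range m, F (2 * v) := by
  rw [sum_range_mul_eq_sum_sum 2 m, Finset.sum_range_succ, Finset.sum_range_one, Finset.mul_sum]
  have h1 : ∑ v ∈ range m, (if 2 ∣ 1 + 2 * v then (2 : ℂ) else 0) * F (1 + 2 * v) = 0 :=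
    Finset.sum_eq_zero fun v _ ↦ by rw [if_neg (by omega), zero_mul]
  rw [h1, add_zero]
  exact Finset.sum_congr rfl fun v _ ↦ by rw [if_pos ⟨v, by ring⟩, zero_add]

/-- **The recursion `G(a, 2^{k+2}; f, 0) = 4·G(a, 2^k; f, 0)` for odd `a` and odd `B`.**
With `x = u + 2^{k+1}s`, `y = u' + 2^{k+1}t`, `s, t ∈ {0, 1}`:
`e(a f(x,y)/2^{k+2}) = e(a f(u,u')/2^{k+2})·e(aB(ut + su')/2)`; `∑_{t<2} e(aBut/2) = 2·[2 ∣ u]`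
and `∑_{s<2} e(aBsu'/2) = 2·[2 ∣ u']` (`a`, `B` odd); finally `a f(2v,2v')/2^{k+2} = a f(v,v')/2^k`
(the two-variable analogue of `G(a; p^{e+2}) = pG(a; p^e)`, factor `p² = 4`).
[cite: AndrianovZhuravlev2015, Ch. 1 §4.5, proof of Lemma 4.13] -/
theorem binQuadGaussSum_two_pow_add_two (f : BinQF) (hb : Odd f.b) {a : ℤ} (ha : Odd a)
    (k : ℕ) : binQuadGaussSum (2 ^ (k + 2)) f a 0 0 = 4 * binQuadGaussSum (2 ^ k) f a 0 0 := by
  obtain ⟨E, hE⟩ : ∃ E : ℕ → ℕ → ℂ, ∀ x y : ℕ, E x y = cexp (2 * Real.pi * I *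
      ((a * (f.a * x ^ 2 + f.b * x * y + f.c * y ^ 2) : ℤ) : ℂ) / (2 ^ (k + 2) : ℕ)) :=
    ⟨_, fun _ _ ↦ rfl⟩
  obtain ⟨E₀, hE₀⟩ : ∃ E₀ : ℕ → ℕ → ℂ, ∀ x y : ℕ, E₀ x y = cexp (2 * Real.pi * I *
      ((a * (f.a * x ^ 2 + f.b * x * y + f.c * y ^ 2) : ℤ) : ℂ) / (2 ^ k : ℕ)) :=
    ⟨_, fun _ _ ↦ rfl⟩
  have hr : range (2 ^ (k + 2)) = range (2 ^ (k + 1) * 2) := by rw [← pow_succ]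
  have hr' : range (2 ^ (k + 1)) = range (2 * 2 ^ k) := by rw [← pow_succ']
  rw [binQuadGaussSum_zero_zero_eq_sum_range, binQuadGaussSum_zero_zero_eq_sum_range]
  simp_rw [← hE, ← hE₀]
  -- (i) the two splitting identities
  have hy : ∀ x u' t : ℕ, E x (u' + 2 ^ (k + 1) * t) =
      E x u' * cexp (2 * Real.pi * I * ((a * f.b * x * t : ℤ) : ℂ) / (2 : ℕ)) := by
    intro x u' t
    rw [hE, hE, ← Complex.exp_add]
    refine cexp_eq_cexp_of_sub_eq (a * f.c * u' * t + a * f.c * 2 ^ k * t ^ 2) ?_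
    push_cast
    field_simp
    ring
  have hx : ∀ u s u' : ℕ, E (u + 2 ^ (k + 1) * s) u' =
      E u u' * cexp (2 * Real.pi * I * ((a * f.b * u' * s : ℤ) : ℂ) / (2 : ℕ)) := by
    intro u s u'
    rw [hE, hE, ← Complex.exp_add]
    refine cexp_eq_cexp_of_sub_eq (a * f.a * u * s + a * f.a * 2 ^ k * s ^ 2) ?_
    push_cast
    field_simp
    ring
  -- (ii) parity: `2 ∣ aBz ↔ 2 ∣ z`, and the two-term character sums
  have hab : ¬ (2 : ℤ) ∣ a * f.b := by
    rw [← even_iff_two_dvd, Int.not_even_iff_odd]; exact ha.mul hb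
  have hpar : ∀ z : ℕ, ((2 : ℤ) ∣ a * f.b * z) ↔ 2 ∣ z := fun z ↦ by
    rw [Int.prime_two.dvd_mul]
    constructor
    · rintro (h | h)
      · exact absurd h hab
      · exact_mod_cast h
    · exact fun h ↦ Or.inr (by exact_mod_cast h)
  have hinner : ∀ z : ℕ, ∑ t ∈ range 2,
      cexp (2 * Real.pi * I * ((a * f.b * z * t : ℤ) : ℂ) / (2 : ℕ)) =
      if 2 ∣ z then (2 : ℂ) else 0 := by
    intro z
    rw [sum_range_cexp_mul_div 2 (a * f.b * z)]
    simp only [Nat.cast_ofNat]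
    by_cases h : 2 ∣ z
    · rw [if_pos ((hpar z).mpr h), if_pos h]
    · rw [if_neg (fun h' ↦ h ((hpar z).mp h')), if_neg h]
  -- (iii) split `y = u' + 2^{k+1}t`
  have step1 : ∀ x : ℕ, ∑ y ∈ range (2 ^ (k + 1) * 2), E x y =
      (if 2 ∣ x then (2 : ℂ) else 0) * ∑ u' ∈ range (2 ^ (k + 1)), E x u' := by
    intro x
    rw [sum_range_mul_eq_sum_sum, Finset.mul_sum]
    refine Finset.sum_congr rfl fun u' _ ↦ ?_
    simp_rw [hy x u']
    rw [← Finset.mul_sum, hinner x, mul_comm]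
  rw [hr]
  simp_rw [step1]
  -- (iv) split `x = u + 2^{k+1}s`
  rw [sum_range_mul_eq_sum_sum]
  have h2M : (2 : ℕ) ∣ 2 ^ (k + 1) := dvd_pow_self 2 (Nat.succ_ne_zero k)
  have step2 : ∀ u : ℕ, ∑ s ∈ range 2, ((if 2 ∣ u + 2 ^ (k + 1) * s then (2 : ℂ) else 0) *
      ∑ u' ∈ range (2 ^ (k + 1)), E (u + 2 ^ (k + 1) * s) u') =
      (if 2 ∣ u then (2 : ℂ) else 0) *
        ∑ u' ∈ range (2 ^ (k + 1)), (if 2 ∣ u' then (2 : ℂ) else 0) * E u u' := by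
    intro u
    have hpu : ∀ s : ℕ, (2 ∣ u + 2 ^ (k + 1) * s ↔ 2 ∣ u) := fun s ↦
      Nat.dvd_add_left (dvd_mul_of_dvd_left h2M s)
    simp_rw [hpu, hx u]
    rw [← Finset.mul_sum]
    congr 1
    rw [Finset.sum_comm]
    refine Finset.sum_congr rfl fun u' _ ↦ ?_
    rw [← Finset.mul_sum, hinner u', mul_comm]
  simp_rw [step2]
  -- (v) only even `u, u'` survive; `f(2v, 2v')/2^{k+2} = f(v, v')/2^k`
  rw [hr', sum_range_two_mul_ite]
  simp_rw [sum_range_two_mul_ite]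
  rw [← Finset.mul_sum, ← mul_assoc, show (2 : ℂ) * 2 = 4 by norm_num]
  congr 1
  refine Finset.sum_congr rfl fun v _ ↦ Finset.sum_congr rfl fun v' _ ↦ ?_
  rw [hE, hE₀]
  refine cexp_eq_cexp_of_sub_eq 0 ?_
  push_cast
  field_simp
  ring

/-! ### Modulus `2`, and the values at `2^k` -/

/-- `e(n/2) = (−1)^n` for an integer `n` (plumbing). [folklore] -/
private theorem cexp_two_pi_I_int_div_two (n : ℤ) :
    cexp (2 * Real.pi * I * (n : ℂ) / (2 : ℕ)) = (-1) ^ n := by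
  rw [show 2 * (Real.pi : ℂ) * I * (n : ℂ) / (2 : ℕ) = n * (Real.pi * I) by push_cast; ring,
    Complex.exp_int_mul, Complex.exp_pi_mul_I]

/-- `B² ≡ 1 (mod 8)` for odd `B` (plumbing). [folklore] -/
private theorem sq_emod_eight_of_odd {B : ℤ} (hB : Odd B) : B * B % 8 = 1 := by
  have h2 : B % 2 = 1 := Int.odd_iff.mp hB
  have hr : B % 8 = 1 ∨ B % 8 = 3 ∨ B % 8 = 5 ∨ B % 8 = 7 := by omega
  rw [Int.mul_emod]
  rcases hr with h | h | h | h <;> rw [h] <;> norm_num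

/-- **`G(a, c; f, 0) = 2·χ₈(D)` for `c = 2`, odd `a` and odd `B`**: the four terms are
`1 + (−1)^A + (−1)^C + (−1)^{A+B+C} = 1 + (−1)^A + (−1)^C − (−1)^{A+C}`, i.e. `2` if `AC` is
even (`D = B² − 4AC ≡ 1 (mod 8)`, `χ₈(D) = 1`) and `−2` if `AC` is odd (`D ≡ 5 (mod 8)`,
`χ₈(D) = −1`) — the Kronecker symbol `(D/2)`, cf. (4.34). [cite: AndrianovZhuravlev2015, Ch. 1 §4.4 Proposition 4.9 with (4.34)] -/
theorem binQuadGaussSum_eq_of_modulus_eq_two {c : ℕ} [NeZero c] (hc : c = 2) (f : BinQF)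
    (hb : Odd f.b) {a : ℤ} (ha : Odd a) :
    binQuadGaussSum c f a 0 0 = 2 * ((ZMod.χ₈ f.disc : ℤ) : ℂ) := by
  subst hc
  rw [binQuadGaussSum_zero_zero_eq_sum_range]
  simp only [Finset.sum_range_succ, Finset.sum_range_zero, zero_add, Nat.cast_zero, Nat.cast_one,
    cexp_two_pi_I_int_div_two]
  -- exponents: `f(0,0) = 0`, `f(0,1) = C`, `f(1,0) = A`, `f(1,1) = A + B + C`
  have e00 : a * (f.a * 0 ^ 2 + f.b * 0 * 0 + f.c * 0 ^ 2) = 0 := by ring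
  have e01 : a * (f.a * 0 ^ 2 + f.b * 0 * 1 + f.c * 1 ^ 2) = a * f.c := by ring
  have e10 : a * (f.a * 1 ^ 2 + f.b * 1 * 0 + f.c * 0 ^ 2) = a * f.a := by ring
  have e11 : a * (f.a * 1 ^ 2 + f.b * 1 * 1 + f.c * 1 ^ 2) = a * f.a + a * f.b + a * f.c := by ring
  rw [e00, e01, e10, e11, zpow_zero, zpow_add₀ (by norm_num : (-1 : ℂ) ≠ 0),
    zpow_add₀ (by norm_num : (-1 : ℂ) ≠ 0), zpow_mul, zpow_mul, zpow_mul, Odd.neg_one_zpow ha,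
    hb.neg_one_zpow]
  -- the discriminant mod 8
  have hB2 : f.b * f.b % 8 = 1 := sq_emod_eight_of_odd hb
  have hdisc : f.disc = f.b * f.b - 4 * (f.a * f.c) := by rw [BinQF.disc]; ring
  rcases Int.even_or_odd f.a with hA | hA <;> rcases Int.even_or_odd f.c with hC | hC
  · -- `A, C` even
    have hD : f.disc % 8 = 1 := by
      obtain ⟨p, hp⟩ := hA.mul_right f.c; rw [hdisc]; omega
    rw [hA.neg_one_zpow, hC.neg_one_zpow, ZMod.χ₈_int_eq_if_mod_eight, if_neg (by omega),
      if_pos (Or.inl hD)]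
    push_cast; ring
  · -- `A` even, `C` odd
    have hD : f.disc % 8 = 1 := by
      obtain ⟨p, hp⟩ := hA.mul_right f.c; rw [hdisc]; omega
    rw [hA.neg_one_zpow, hC.neg_one_zpow, ZMod.χ₈_int_eq_if_mod_eight, if_neg (by omega),
      if_pos (Or.inl hD)]
    push_cast; ring
  · -- `A` odd, `C` even
    have hD : f.disc % 8 = 1 := by
      obtain ⟨p, hp⟩ := hC.mul_left f.a; rw [hdisc]; omega
    rw [hA.neg_one_zpow, hC.neg_one_zpow, ZMod.χ₈_int_eq_if_mod_eight, if_neg (by omega),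
      if_pos (Or.inl hD)]
    push_cast; ring
  · -- `A, C` odd
    have hD : f.disc % 8 = 5 := by
      have hAC : f.a * f.c % 2 = 1 := Int.odd_iff.mp (hA.mul hC)
      rw [hdisc]; omega
    rw [hA.neg_one_zpow, hC.neg_one_zpow, ZMod.χ₈_int_eq_if_mod_eight, if_neg (by omega),
      if_neg (by omega)]
    push_cast; ring

/-- **`G(a, 2^k; f, 0) = χ₈(D)^k · 2^k` for odd `a` and odd `B`** (so `|G| = 2^k` and the sign is
the Kronecker symbol `(D/2)^k`): two-step induction from `c = 1`, `c = 2` and the recursion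
`G_{2^{k+2}} = 4G_{2^k}` (`χ₈(D)² = 1`). [cite: AndrianovZhuravlev2015, Ch. 1 §4.4 Proposition 4.9 with (4.34), §4.5 Lemma 4.13] -/
theorem binQuadGaussSum_two_pow_eq (f : BinQF) (hb : Odd f.b) {a : ℤ} (ha : Odd a) (k : ℕ) :
    binQuadGaussSum (2 ^ k) f a 0 0 = ((ZMod.χ₈ f.disc : ℤ) : ℂ) ^ k * 2 ^ k := by
  have hχ : ((ZMod.χ₈ f.disc : ℤ) : ℂ) ^ 2 = 1 := by
    have hodd : Odd f.disc := by
      rw [BinQF.disc, show f.b ^ 2 - 4 * f.a * f.c = f.b ^ 2 + 2 * (-(2 * f.a * f.c)) by ring]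
      exact (hb.pow).add_even (even_two_mul _)
    rw [ZMod.χ₈_int_eq_if_mod_eight]
    have : f.disc % 2 = 1 := Int.odd_iff.mp hodd
    rw [if_neg (by omega)]
    split_ifs <;> norm_num
  induction k using Nat.twoStepInduction with
  | zero =>
    rw [binQuadGaussSum_eq_one_of_modulus_eq_one (pow_zero 2), pow_zero, pow_zero, mul_one]
  | one =>
    rw [binQuadGaussSum_eq_of_modulus_eq_two (pow_one 2) f hb ha, pow_one, pow_one, mul_comm]
  | more k ih0 _ =>
    rw [binQuadGaussSum_two_pow_add_two f hb ha k, ih0]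
    linear_combination (-(((ZMod.χ₈ f.disc : ℤ) : ℂ) ^ k * 2 ^ k * 4)) * hχ

/-- In particular `|G(a, 2^k; f, 0)| = 2^k` for odd `a`, `B`.
[cite: AndrianovZhuravlev2015, Ch. 1 §4.4 Proposition 4.9 with (4.34)] -/
theorem norm_binQuadGaussSum_two_pow (f : BinQF) (hb : Odd f.b) {a : ℤ} (ha : Odd a) (k : ℕ) :
    ‖binQuadGaussSum (2 ^ k) f a 0 0‖ = 2 ^ k := by
  have hodd : Odd f.disc := by
    rw [BinQF.disc, show f.b ^ 2 - 4 * f.a * f.c = f.b ^ 2 + 2 * (-(2 * f.a * f.c)) by ring]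
    exact (hb.pow).add_even (even_two_mul _)
  have hχ : ‖((ZMod.χ₈ f.disc : ℤ) : ℂ)‖ = 1 := by
    rw [ZMod.χ₈_int_eq_if_mod_eight]
    have : f.disc % 2 = 1 := Int.odd_iff.mp hodd
    rw [if_neg (by omega)]
    split_ifs <;> norm_num
  rw [binQuadGaussSum_two_pow_eq f hb ha k, norm_mul, norm_pow, hχ, one_pow, one_mul, norm_pow,
    Complex.norm_ofNat]

end Literature.NumberTheory.ModularForms

end
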